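import Literature.NumberTheory.LFunctions.Zhang2022.Section2JointRobustness

/-!
# Zhang 2022, the final step of §2 at main order: the joint radius by an analytic (Weyl) bound

Trunk T-NT (NumberTheory/LFunctions), the Landau–Siegel manuscript [Zhang2022LandauSiegel]
(Y. Zhang, *Discrete mean estimates and the Landau–Siegel zero*, arXiv:2211.02515v1 — an unrefereed
manuscript, a claimed result under adjudication; audit + repair census, no claim about Landau–Siegel).

`Section2JointRobustness` brackets the least sup-size `ρ*` of a joint perturbation `(D, d)` of the thirteen
entry-level constants of the final step of §2 at main order (the Hermitian matrix `Q` of the (2.32)-side and the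
coefficients `A₀, A₂, A₃, A₄` of `𝔡′(ι) + 𝔡(ι)`) under which SOME `ι ∈ ℂ³` closes the step:
`3·10⁻⁴ ≤ ρ* < 6.64·10⁻⁴` (`joint_radius_bracket`), the lower number by ONE interval-Gershgorin kernel test on the
box table widened by `3·10⁻⁴·2^48` (`certR`).  The widening costs a factor `≈ 1.8` against the analytic value.
This file sharpens the LOWER number to **`5.43·10⁻⁴`** by separating the two roles of the kernel:

* `cert0` / `N0S_posSemidef` — the kernel certifies ONCE, on the UNWIDENED literal boxes, the spectral bound
  `N₀ − 7.27·I ⪰ 0` for `N₀ = 2546·Q − a a*` (`NP 0 0`; the true least eigenvalue is `7.273…`), i.e.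
  `Re x*N₀x ≥ 7.27·|x|²` (`form_NP0_re_ge`, `|x|² = 1 + |ι₂|² + |ι₃|² + |ι₄|²`);
* the perturbation is then controlled ANALYTICALLY for every admissible `(D, d)` of size `ε` (`Small ε D d`):
  `|Re x*Dx| ≤ (1 + 3√2)·ε·|x|²` (`re_formD_abs_le`: Schur test, a Hermitian `D` has real diagonal, an entry with
  both parts `≤ ε` has modulus `≤ √2·ε`, here `√2 ≤ 1.41422`), and
  `|L′(ι)|² ≤ |L(ι)|² + (4√2·‖a‖⁺·ε + 8ε²)·|x|²` with `‖a‖ ≤ ‖a‖⁺ = 5.1623` (`normSq_LformP_le`: Cauchy–Schwarz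
  twice, the coefficient norms from the literal boxes `ALit0…ALit4`, `sq_norm_avec_le`);
* hence `|L′(ι)|² ≤ 2546·C₂₃₂′(ι)` whenever `2546·(1 + 3√2)·ε + 4√2·‖a‖⁺·ε + 8ε² ≤ 7.27`, in particular for all
  **`ε ≤ 5.43·10⁻⁴`** (`normSq_LP_le_weyl`; the threshold of this inequality is `5.4347·10⁻⁴`), and the perturbed
  final step fails for every such `(D, d)` and every `ι ∈ ℂ³`, in both readings of `C₂₃₃`
  (`not_mainOrderContradictionP_weyl`);
* `joint_radius_bracket_weyl` — with the parent file's witness of size `6.64·10⁻⁴`: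
  **`5.43·10⁻⁴ ≤ ρ* < 6.64·10⁻⁴`** (outside Lean, with the multiplier `C₂₃₃ = 2546.85` in place of `2546` and exact
  `√2`, `‖a‖`: `5.438·10⁻⁴ ≤ ρ* ≤ 6.628·10⁻⁴`; the manuscript quotes these constants to `10⁻⁵`).

As everywhere in this series nothing is asserted about the manuscript's Theorems 1–2: the statements concern the
printed main-order constants as functions of the free parameters `ι` and a fictitious perturbation `(D, d)`.

## Method

Weyl's inequality in quadratic-form dress: `Re x*(N₀ + 2546·D)x − |L + δ|² ≥ (λ₀ − κ(ε))·|x|²` with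
`λ₀ = 7.27` certified by `hermPsdCheck` on the box table `N0SBox` of `N₀ − λ₀I` (the parent file's `NPBox 0` with
`λ₀` subtracted on the diagonal; integer approximate eigenbasis `V0`, columns scaled by `λ^{-1/2}`, computed
outside Lean; `decide +kernel`) and `κ(ε) = 2546(1 + 3s)ε + 4s·‖a‖⁺·ε + 4s²ε²`, `s = 1.41422`, by the elementary
estimates `quad_abs_le` (row sums `ε + 3sε` and `2|x_i||x_j| ≤ |x_i|² + |x_j|²`) and `normSq_LformP_le`.
No facts, no axioms beyond the parent files'.

## Main results
* `cert0`, `N0S_posSemidef`, `form_NP0_re_ge` — `Re x*(2546·Q − a a*)x ≥ 7.27·|x|²`.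
* `re_formD_abs_le`, `sq_norm_avec_le`, `normSq_LformP_le` — the analytic perturbation bounds.
* `normSq_LP_le_weyl`, `not_mainOrderContradictionP_weyl`, `joint_radius_bracket_weyl`.
-/

noncomputable section

open Real Complex ComplexConjugate Matrix
open scoped ComplexOrder
open Literature.Analysis.ValidatedNumerics.Numerics
open Literature.Analysis.ValidatedNumerics.IntervalGershgorin

namespace Literature.NumberTheory.LFunctions.Zhang2022

/-! ### The certified spectral bound `2546·Q − a a* ⪰ 7.27` -/

/-- the certified lower eigenvalue bound `λ₀ = 7.27` of `N₀ = 2546·Q − a a*` (true value `7.2732…`). [folklore] -/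
def lam0 : ℚ := 727 / 100

/-- `N₀ − λ₀·I` with `N₀ = NP 0 0 = 2546·Q − a a*`. [folklore] -/
def N0S : Matrix (Fin 4) (Fin 4) ℂ := NP 0 0 - ((lam0 : ℚ) : ℂ) • (1 : Matrix (Fin 4) (Fin 4) ℂ)

/-- `N₀ − λ₀·I` is Hermitian. [folklore] -/
theorem N0S_conjTranspose : N0Sᴴ = N0S := by
  have h0 : (NP 0 0)ᴴ = NP 0 0 := NP_conjTranspose Matrix.conjTranspose_zero 0
  rw [N0S, conjTranspose_sub, conjTranspose_smul, conjTranspose_one, h0]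
  congr 2
  simp

/-- box table of `N₀ − λ₀·I`: the parent file's unwidened table `NPBox 0` with `λ₀` subtracted on the diagonal.
[folklore] -/
def N0SBox : CMat 4 := fun i j => if i = j then (NPBox 0 i j).sub (qCB lam0) else NPBox 0 i j

/-- `N₀ − λ₀·I ∈ N0SBox` entrywise. [folklore] -/
theorem mem_N0SBox : CMMem N0S N0SBox := by
  have hNP : CMMem (NP 0 0) (NPBox 0) := mem_NPBox (small_zero le_rfl) (by simp)
  intro i j
  by_cases hij : i = j
  · subst hij
    have e : N0S i i = NP 0 0 i i - ((lam0 : ℚ) : ℂ) := by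
      simp [N0S, Matrix.sub_apply, Matrix.smul_apply, Matrix.one_apply_eq]
    simp only [N0SBox, e, if_true]
    exact CB.mem_sub (hNP i i) (mem_qCB lam0)
  · have e : N0S i j = NP 0 0 i j := by
      simp [N0S, Matrix.sub_apply, Matrix.smul_apply, Matrix.one_apply_ne hij]
    simp only [N0SBox, if_neg hij, e]
    exact hNP i j

/-- integer approximate eigenbasis of the realified midpoint of `N0SBox` (columns scaled by `λ^{-1/2}`;
eigenvalues `0.0033, 36.0, 6227, 19018`, each twice), computed outside Lean. [folklore] -/
def V0 : Fin (4 + 4) → Fin (4 + 4) → ℤ :=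
  ![![-1536553087, -146749911, 432, 7778149, -24392, -130117, -371791, -83186],
    ![-2615134302, 2669567, 155478, -4573795, -106942, -659741, 76347, -4398],
    ![1517831195, -246256105, -1424600, -7538093, 3386, -139981, -384555, 441],
    ![2558583793, 560779788, -266893, 4546853, 286, -668399, 73805, 19879],
    ![146749911, -1536553087, -7778149, 432, 130117, -24392, 83186, -371791],
    ![-2669567, -2615134302, 4573795, 155478, 659741, -106942, 4398, 76347],
    ![246256105, 1517831195, 7538093, -1424600, 139981, 3386, -441, -384555],
    ![-560779788, 2558583793, -4546853, -266893, 668399, 286, -19879, 73805]]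

/-- **Kernel certificate**: the interval Gershgorin test passes on the box table of `N₀ − 7.27·I`. [folklore] -/
theorem cert0 : hermPsdCheck N0SBox V0 = true := by
  decide +kernel

/-- **`2546·Q − a a* − 7.27·I ⪰ 0`.** [folklore] -/
theorem N0S_posSemidef : N0S.PosSemidef :=
  posSemidef_of_hermPsdCheck cert0 mem_N0SBox N0S_conjTranspose

/-- `|x|² = 1 + |ι₂|² + |ι₃|² + |ι₄|²` for `x = (1, ι₂, ι₃, ι₄)`. [folklore] -/
def Xn (w2 w3 w4 : ℂ) : ℝ := 1 + ‖w2‖ ^ 2 + ‖w3‖ ^ 2 + ‖w4‖ ^ 2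

/-- [folklore] -/
theorem Xn_pos (w2 w3 w4 : ℂ) : 0 < Xn w2 w3 w4 := by unfold Xn; positivity

/-- `Re x*x = |x|²`. [folklore] -/
theorem re_dot_xvec (w2 w3 w4 : ℂ) :
    (star (xvec w2 w3 w4) ⬝ᵥ xvec w2 w3 w4).re = Xn w2 w3 w4 := by
  unfold Xn
  rw [Complex.sq_norm, Complex.sq_norm, Complex.sq_norm]
  simp only [xvec, dotProduct, Fin.sum_univ_four, Matrix.cons_val_zero, Matrix.cons_val_one, Matrix.cons_val,
    Pi.star_apply, Complex.star_def, map_one, one_mul, Complex.add_re, Complex.one_re, Complex.mul_re,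
    Complex.conj_re, Complex.conj_im, Complex.normSq_apply]
  ring

/-- `Re x*(N₀ − λ₀I)x = Re x*N₀x − λ₀·|x|²`. [folklore] -/
theorem re_form_N0S (w2 w3 w4 : ℂ) :
    (star (xvec w2 w3 w4) ⬝ᵥ (N0S *ᵥ xvec w2 w3 w4)).re
      = (star (xvec w2 w3 w4) ⬝ᵥ (NP 0 0 *ᵥ xvec w2 w3 w4)).re - (lam0 : ℝ) * Xn w2 w3 w4 := by
  rw [N0S, sub_mulVec, dotProduct_sub, smul_mulVec, one_mulVec, dotProduct_smul, Complex.sub_re, smul_eq_mul,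
    ← re_dot_xvec]
  congr 1
  rw [← Complex.ofReal_ratCast, Complex.re_ofReal_mul]

/-- **`Re x*(2546·Q − a a*)x ≥ 7.27·|x|²` for every `x = (1, ι₂, ι₃, ι₄)`.** [folklore] -/
theorem form_NP0_re_ge (w2 w3 w4 : ℂ) :
    (lam0 : ℝ) * Xn w2 w3 w4 ≤ (star (xvec w2 w3 w4) ⬝ᵥ (NP 0 0 *ᵥ xvec w2 w3 w4)).re := by
  have h0 := N0S_posSemidef.dotProduct_mulVec_nonneg (xvec w2 w3 w4)
  rw [Complex.nonneg_iff] at h0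
  have h1 := h0.1
  rw [re_form_N0S] at h1
  linarith

/-- at `D = 0`, `d = 0`: `Re x*N₀x = 2546·C₂₃₂(ι) − |L(ι)|²`. [folklore] -/
theorem form_NP0_re (w2 w3 w4 : ℂ) :
    (star (xvec w2 w3 w4) ⬝ᵥ (NP 0 0 *ᵥ xvec w2 w3 w4)).re
      = 2546 * C232cG w2 w3 w4 - Complex.normSq (Lform w2 w3 w4) := by
  rw [form_NP_re]
  have e1 : C232P 0 w2 w3 w4 = C232cG w2 w3 w4 := by simp [C232P]
  have e2 : LformP 0 w2 w3 w4 = Lform w2 w3 w4 := by simp [LformP, Lform]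
  rw [e1, e2]

/-! ### Analytic control of the perturbation -/

/-- the rational upper bound `1.41422` of `√2`. [folklore] -/
def s2 : ℝ := 141422 / 100000

/-- an entry with both parts `≤ ε` in absolute value has modulus `≤ 1.41422·ε`. [folklore] -/
theorem norm_le_s2_mul {z : ℂ} {ε : ℝ} (hr : |z.re| ≤ ε) (hi : |z.im| ≤ ε) : ‖z‖ ≤ s2 * ε := by
  have hε : 0 ≤ ε := (abs_nonneg _).trans hr
  refine le_of_sq_le_sq ?_ (mul_nonneg (by norm_num [s2]) hε)
  rw [Complex.sq_norm, Complex.normSq_apply]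
  have h1 := sq_le_sq' (abs_le.1 hr).1 (abs_le.1 hr).2
  have h2 := sq_le_sq' (abs_le.1 hi).1 (abs_le.1 hi).2
  have h3 : 2 * ε ^ 2 ≤ (s2 * ε) ^ 2 := by
    rw [mul_pow]; exact mul_le_mul_of_nonneg_right (by norm_num [s2]) (sq_nonneg ε)
  nlinarith

/-- a real entry with `|re| ≤ ε` has modulus `≤ ε`. [folklore] -/
theorem norm_le_of_im_eq_zero {z : ℂ} {ε : ℝ} (hr : |z.re| ≤ ε) (hi : z.im = 0) : ‖z‖ ≤ ε := by
  have h := Complex.norm_le_abs_re_add_abs_im z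
  rw [hi, abs_zero, add_zero] at h
  exact h.trans hr

/-- `|x*Dx| ≤ Σ |D_ij|·|x_i|·|x_j|`. [folklore] -/
theorem norm_form_le (D : Matrix (Fin 4) (Fin 4) ℂ) (x : Fin 4 → ℂ) :
    ‖star x ⬝ᵥ (D *ᵥ x)‖ ≤ ∑ i, ∑ j, ‖D i j‖ * (‖x i‖ * ‖x j‖) := by
  simp only [dotProduct, Matrix.mulVec, Pi.star_apply, Finset.mul_sum]
  refine (norm_sum_le _ _).trans (Finset.sum_le_sum fun i _ => (norm_sum_le _ _).trans
    (Finset.sum_le_sum fun j _ => ?_))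
  rw [norm_mul, norm_mul, norm_star]
  exact le_of_eq (by ring)

/-- the Schur test for a `4 × 4` table with diagonal `≤ ε` and off-diagonal `≤ s·ε` (`1 ≤ s`):
`Σ a_ij n_i n_j ≤ (1 + 3s)·ε·Σ n_i²`. [folklore] -/
theorem quad_abs_le {a : Fin 4 → Fin 4 → ℝ} {n : Fin 4 → ℝ} {ε s : ℝ} (hs : 1 ≤ s) (hε : 0 ≤ ε)
    (hn : ∀ i, 0 ≤ n i) (hd : ∀ i, a i i ≤ ε) (ho : ∀ i j, a i j ≤ s * ε) :
    ∑ i, ∑ j, a i j * (n i * n j) ≤ (1 + 3 * s) * ε * ∑ i, n i ^ 2 := by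
  have P : ∀ i j, a i j * (n i * n j) ≤ s * ε * (n i * n j) := fun i j =>
    mul_le_mul_of_nonneg_right (ho i j) (mul_nonneg (hn i) (hn j))
  have Q : ∀ i, a i i * (n i * n i) ≤ ε * (n i * n i) := fun i =>
    mul_le_mul_of_nonneg_right (hd i) (mul_nonneg (hn i) (hn i))
  have R : ∀ i j, s * ε * (2 * n i * n j) ≤ s * ε * (n i ^ 2 + n j ^ 2) := fun i j =>
    mul_le_mul_of_nonneg_left (two_mul_le_add_sq _ _) (mul_nonneg (zero_le_one.trans hs) hε)
  simp only [Fin.sum_univ_four]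
  linarith [Q 0, Q 1, Q 2, Q 3, P 0 1, P 0 2, P 0 3, P 1 0, P 1 2, P 1 3, P 2 0, P 2 1, P 2 3, P 3 0, P 3 1,
    P 3 2, R 0 1, R 0 2, R 0 3, R 1 2, R 1 3, R 2 3]

/-- `Σ |x_i|² = |x|²`. [folklore] -/
theorem sum_sq_norm_xvec (w2 w3 w4 : ℂ) : ∑ i, ‖xvec w2 w3 w4 i‖ ^ 2 = Xn w2 w3 w4 := by
  simp [xvec, Fin.sum_univ_four, Xn]

/-- **`|Re x*Dx| ≤ (1 + 3·1.41422)·ε·|x|²` for every admissible `D` of size `ε`.** [folklore] -/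
theorem re_formD_abs_le {ε : ℝ} {D : Matrix (Fin 4) (Fin 4) ℂ} {d : Fin 4 → ℂ} (hS : Small ε D d)
    (w2 w3 w4 : ℂ) :
    |(star (xvec w2 w3 w4) ⬝ᵥ (D *ᵥ xvec w2 w3 w4)).re| ≤ (1 + 3 * s2) * ε * Xn w2 w3 w4 := by
  obtain ⟨hH, hD, -⟩ := hS
  have hε : 0 ≤ ε := (abs_nonneg _).trans (hD 0 0).1
  have hdiag : ∀ i, ‖D i i‖ ≤ ε := fun i => by
    have him : (D i i).im = 0 := by
      have h1 := congrFun (congrFun hH i) i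
      simp only [Matrix.conjTranspose_apply, Complex.star_def] at h1
      exact Complex.conj_eq_iff_im.1 h1
    exact norm_le_of_im_eq_zero (hD i i).1 him
  have hoff : ∀ i j, ‖D i j‖ ≤ s2 * ε := fun i j => norm_le_s2_mul (hD i j).1 (hD i j).2
  refine (Complex.abs_re_le_norm _).trans ((norm_form_le D _).trans ?_)
  rw [← sum_sq_norm_xvec]
  exact quad_abs_le (by norm_num [s2]) hε (fun i => norm_nonneg _) hdiag hoff

/-- squared modulus from a literal box: `|z|²·2^96 ≤ Mr² + Mi²` when the box lies in `[−Mr, Mr] × [−Mi, Mi]`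
(scaled). [folklore] -/
theorem sq_norm_le_of_mem {z : ℂ} {B : CB} (h : CB.mem z B) (Mr Mi : ℕ)
    (hr : -(Mr : ℤ) ≤ B.re.lo ∧ B.re.hi ≤ Mr) (hi : -(Mi : ℤ) ≤ B.im.lo ∧ B.im.hi ≤ Mi) :
    ‖z‖ ^ 2 * (SC : ℝ) ^ 2 ≤ (Mr : ℝ) ^ 2 + (Mi : ℝ) ^ 2 := by
  obtain ⟨⟨h1, h2⟩, ⟨h3, h4⟩⟩ := h
  obtain ⟨hr1, hr2⟩ := hr
  obtain ⟨hi1, hi2⟩ := hi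
  have hr1' : (-(Mr : ℤ) : ℝ) ≤ (B.re.lo : ℝ) := by exact_mod_cast hr1
  have hr2' : (B.re.hi : ℝ) ≤ ((Mr : ℤ) : ℝ) := by exact_mod_cast hr2
  have hi1' : (-(Mi : ℤ) : ℝ) ≤ (B.im.lo : ℝ) := by exact_mod_cast hi1
  have hi2' : (B.im.hi : ℝ) ≤ ((Mi : ℤ) : ℝ) := by exact_mod_cast hi2
  push_cast at hr1' hr2' hi1' hi2'
  have er : (z.re * SC) ^ 2 ≤ (Mr : ℝ) ^ 2 := sq_le_sq' (by linarith) (by linarith)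
  have ei : (z.im * SC) ^ 2 ≤ (Mi : ℝ) ^ 2 := sq_le_sq' (by linarith) (by linarith)
  rw [Complex.sq_norm, Complex.normSq_apply]
  nlinarith

/-- the rational upper bound `26.64743` of `|A₀|² + |A₂|² + |A₃|² + |A₄|²` (true value `26.6474288…`). [folklore] -/
def Asq : ℝ := 2664743 / 100000

/-- **`|A₀|² + |A₂|² + |A₃|² + |A₄|² ≤ 26.64743`** from the literal boxes `ALit0…ALit4`. [folklore] -/
theorem sq_norm_avec_le : ‖A0‖ ^ 2 + ‖A2‖ ^ 2 + ‖A3‖ ^ 2 + ‖A4‖ ^ 2 ≤ Asq := by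
  have h0 := sq_norm_le_of_mem mem_A0L 13374126754258 11218027476087 (by norm_num [ALit0]) (by norm_num [ALit0])
  have h2 := sq_norm_le_of_mem mem_A2L 6058629341249 4379395211944 (by norm_num [ALit2]) (by norm_num [ALit2])
  have h3 := sq_norm_le_of_mem mem_A3L 1452860868458273 1889046620130 (by norm_num [ALit3]) (by norm_num [ALit3])
  have h4 := sq_norm_le_of_mem mem_A4L 6044343418447 4627736615762 (by norm_num [ALit4]) (by norm_num [ALit4])
  norm_num [SC, Asq] at h0 h2 h3 h4 ⊢
  linarith

/-- the rational upper bound `5.1623` of `‖a‖ = (Σ |A_k|²)^{1/2}`. [folklore] -/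
def Aup : ℝ := 51623 / 10000

/-- **`|L′(ι)|² ≤ |L(ι)|² + (4s·‖a‖⁺·ε + 4s²ε²)·|x|²`** for every admissible `d` of size `ε` (`s = 1.41422`,
`‖a‖⁺ = 5.1623`): `|L′| ≤ |L| + |δ|`, `|δ| ≤ sε(1 + |ι₂| + |ι₃| + |ι₄|) ≤ 2sε|x|`, `|L| ≤ ‖a‖·|x|`. [folklore] -/
theorem normSq_LformP_le {ε : ℝ} {D : Matrix (Fin 4) (Fin 4) ℂ} {d : Fin 4 → ℂ} (hS : Small ε D d)
    (w2 w3 w4 : ℂ) :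
    Complex.normSq (LformP d w2 w3 w4)
      ≤ Complex.normSq (Lform w2 w3 w4) + (4 * s2 * Aup * ε + 4 * s2 ^ 2 * ε ^ 2) * Xn w2 w3 w4 := by
  obtain ⟨-, -, hd⟩ := hS
  have hε : 0 ≤ ε := (abs_nonneg _).trans (hd 0).1
  have hdk : ∀ k, ‖d k‖ ≤ s2 * ε := fun k => norm_le_s2_mul (hd k).1 (hd k).2
  have hs : (0 : ℝ) ≤ s2 := by norm_num [s2]
  have hX : 0 ≤ Xn w2 w3 w4 := (Xn_pos w2 w3 w4).le
  -- names for the pieces (no abstraction of occurrences)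
  obtain ⟨L, hL⟩ : ∃ L : ℂ, L = Lform w2 w3 w4 := ⟨_, rfl⟩
  obtain ⟨δ, hδ⟩ : ∃ δ : ℂ, δ = d 0 + w2 * d 1 + w3 * d 2 + w4 * d 3 := ⟨_, rfl⟩
  obtain ⟨P, hP⟩ : ∃ P : ℝ, P = ‖A0‖ + ‖A2‖ * ‖w2‖ + ‖A3‖ * ‖w3‖ + ‖A4‖ * ‖w4‖ := ⟨_, rfl⟩
  obtain ⟨S, hSd⟩ : ∃ S : ℝ, S = 1 + ‖w2‖ + ‖w3‖ + ‖w4‖ := ⟨_, rfl⟩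
  have eδ : LformP d w2 w3 w4 = L + δ := by rw [hL, hδ]; unfold LformP Lform; ring
  have hP0 : 0 ≤ P := by rw [hP]; positivity
  have hS0 : 0 ≤ S := by rw [hSd]; positivity
  -- `|L| ≤ P`
  have hLb : ‖L‖ ≤ P := by
    rw [hL, hP]; unfold Lform
    have t1 := norm_add_le (A0 + w2 * A2 + w3 * A3) (w4 * A4)
    have t2 := norm_add_le (A0 + w2 * A2) (w3 * A3)
    have t3 := norm_add_le A0 (w2 * A2)
    rw [norm_mul] at t1 t2 t3
    linarith
  -- `|δ| ≤ sεS`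
  have hδb : ‖δ‖ ≤ s2 * ε * S := by
    rw [hδ, hSd]
    have t1 := norm_add_le (d 0 + w2 * d 1 + w3 * d 2) (w4 * d 3)
    have t2 := norm_add_le (d 0 + w2 * d 1) (w3 * d 2)
    have t3 := norm_add_le (d 0) (w2 * d 1)
    rw [norm_mul] at t1 t2 t3
    have u1 := mul_le_mul_of_nonneg_left (hdk 1) (norm_nonneg w2)
    have u2 := mul_le_mul_of_nonneg_left (hdk 2) (norm_nonneg w3)
    have u3 := mul_le_mul_of_nonneg_left (hdk 3) (norm_nonneg w4)
    have u0 := hdk 0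
    linarith
  -- Cauchy–Schwarz twice
  have hP2 : P ^ 2 ≤ Asq * Xn w2 w3 w4 := by
    have hAX := mul_le_mul_of_nonneg_right sq_norm_avec_le hX
    rw [hP]; unfold Xn at hAX ⊢
    nlinarith [sq_nonneg (‖A0‖ * ‖w2‖ - ‖A2‖), sq_nonneg (‖A0‖ * ‖w3‖ - ‖A3‖), sq_nonneg (‖A0‖ * ‖w4‖ - ‖A4‖),
      sq_nonneg (‖A2‖ * ‖w3‖ - ‖A3‖ * ‖w2‖), sq_nonneg (‖A2‖ * ‖w4‖ - ‖A4‖ * ‖w2‖),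
      sq_nonneg (‖A3‖ * ‖w4‖ - ‖A4‖ * ‖w3‖)]
  have hS2 : S ^ 2 ≤ 4 * Xn w2 w3 w4 := by
    rw [hSd]; unfold Xn
    nlinarith [sq_nonneg (‖w2‖ - 1), sq_nonneg (‖w3‖ - 1), sq_nonneg (‖w4‖ - 1), sq_nonneg (‖w2‖ - ‖w3‖),
      sq_nonneg (‖w2‖ - ‖w4‖), sq_nonneg (‖w3‖ - ‖w4‖)]
  have hPS : P * S ≤ 2 * Aup * Xn w2 w3 w4 := by
    refine le_of_sq_le_sq ?_ (by unfold Aup; positivity)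
    have hq : Asq * 4 ≤ (2 * Aup) ^ 2 := by norm_num [Asq, Aup]
    have h3 := mul_le_mul hP2 hS2 (sq_nonneg _) (by unfold Asq; positivity)
    have h4 := mul_le_mul_of_nonneg_right hq (mul_nonneg hX hX)
    nlinarith
  -- combine
  have hn : ‖LformP d w2 w3 w4‖ ≤ ‖L‖ + ‖δ‖ := by rw [eδ]; exact norm_add_le _ _
  have h1 : ‖LformP d w2 w3 w4‖ ^ 2 ≤ (‖L‖ + ‖δ‖) ^ 2 := pow_le_pow_left₀ (norm_nonneg _) hn 2
  have i1 : ‖L‖ * ‖δ‖ ≤ P * (s2 * ε * S) := mul_le_mul hLb hδb (norm_nonneg _) hP0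
  have i2 : ‖δ‖ * ‖δ‖ ≤ (s2 * ε * S) * (s2 * ε * S) := mul_le_mul hδb hδb (norm_nonneg _) (by positivity)
  have i3 : P * (s2 * ε * S) ≤ s2 * ε * (2 * Aup * Xn w2 w3 w4) := by
    have := mul_le_mul_of_nonneg_left hPS (mul_nonneg hs hε); linarith
  have i4 : (s2 * ε * S) * (s2 * ε * S) ≤ s2 ^ 2 * ε ^ 2 * (4 * Xn w2 w3 w4) := by
    have := mul_le_mul_of_nonneg_left hS2 (sq_nonneg (s2 * ε)); linarith
  rw [← Complex.sq_norm, ← Complex.sq_norm, ← hL]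
  linarith

/-! ### The lower side: nothing closes at size `≤ 5.43·10⁻⁴` -/

/-- **`|L′(ι)|² ≤ 2546·C₂₃₂′(ι)` for every `ι ∈ ℂ³` and every admissible `(D, d)` of size `ε ≤ 5.43·10⁻⁴`.**
[folklore] -/
theorem normSq_LP_le_weyl {ε : ℝ} {D : Matrix (Fin 4) (Fin 4) ℂ} {d : Fin 4 → ℂ} (hS : Small ε D d)
    (hε : ε ≤ 543 / 1000000) (w2 w3 w4 : ℂ) :
    Complex.normSq (LP d w2 w3 w4) ≤ 2546 * C232P D w2 w3 w4 := by
  have hε0 : 0 ≤ ε := (abs_nonneg _).trans (hS.2.1 0 0).1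
  have hB1 := form_NP0_re_ge w2 w3 w4
  rw [form_NP0_re] at hB1
  have hB2 := abs_le.1 (re_formD_abs_le hS w2 w3 w4)
  have hB3 := normSq_LformP_le hS w2 w3 w4
  have hX : 0 ≤ Xn w2 w3 w4 := (Xn_pos w2 w3 w4).le
  have hk : 2546 * ((1 + 3 * s2) * ε) + (4 * s2 * Aup * ε + 4 * s2 ^ 2 * ε ^ 2) ≤ (lam0 : ℝ) := by
    have h2 : ε ^ 2 ≤ (543 / 1000000 : ℝ) ^ 2 := pow_le_pow_left₀ hε0 hε 2
    norm_num [s2, Aup, lam0] at h2 ⊢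
    linarith
  have hkX := mul_le_mul_of_nonneg_right hk hX
  rw [LP_eq]
  unfold C232P
  nlinarith

/-- **Joint robustness, sharpened.**  For every Hermitian perturbation `D` of `Q` and every perturbation `d` of
`(A₀, A₂, A₃, A₄)` with all real and imaginary parts at most `5.43·10⁻⁴` in absolute value, and every
`ι = (ι₂, ι₃, ι₄) ∈ ℂ³`, the perturbed final step of §2 at main order fails, in both readings of `C₂₃₃`. [folklore] -/
theorem not_mainOrderContradictionP_weyl {ε : ℝ} {D : Matrix (Fin 4) (Fin 4) ℂ} {d : Fin 4 → ℂ}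
    (hS : Small ε D d) (hε : ε ≤ 543 / 1000000) (w2 w3 w4 : ℂ) :
    ¬ MainOrderContradictionP D d w2 w3 w4 C233 ∧ ¬ MainOrderContradictionP D d w2 w3 w4 C233lit := by
  have hk := normSq_LP_le_weyl hS hε w2 w3 w4
  have hpos : 0 ≤ C232P D w2 w3 w4 := by nlinarith [Complex.normSq_nonneg (LP d w2 w3 w4)]
  exact ⟨not_sqrt_lt_of_normSq_le hk hpos (by linarith [C233_bounds.1]),
    not_sqrt_lt_of_normSq_le hk hpos (by linarith [C233lit_bounds.1])⟩

/-- **The sharpened bracket of the joint radius**: `5.43·10⁻⁴ ≤ ρ* < 6.64·10⁻⁴` — nothing closes at size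
`≤ 5.43·10⁻⁴` (this file); the parent file's `(D_w, d_w)` of size `6.64·10⁻⁴` closes at `ι_w`. [folklore] -/
theorem joint_radius_bracket_weyl :
    (∀ (ε : ℝ) (D : Matrix (Fin 4) (Fin 4) ℂ) (d : Fin 4 → ℂ), Small ε D d → ε ≤ 543 / 1000000 →
        ∀ w2 w3 w4 : ℂ, ¬ MainOrderContradictionP D d w2 w3 w4 C233)
    ∧ (∃ (D : Matrix (Fin 4) (Fin 4) ℂ) (d : Fin 4 → ℂ), Small ((664 : ℝ) / 1000000) D d ∧
        ∃ w2 w3 w4 : ℂ, MainOrderContradictionP D d w2 w3 w4 C233) :=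
  ⟨fun _ _ _ hS hε w2 w3 w4 => (not_mainOrderContradictionP_weyl hS hε w2 w3 w4).1, joint_radius_bracket.2⟩

/-- the parent file's radius `3·10⁻⁴` is recovered. [folklore] -/
theorem not_mainOrderContradictionP_of_weyl {ε : ℝ} {D : Matrix (Fin 4) (Fin 4) ℂ} {d : Fin 4 → ℂ}
    (hS : Small ε D d) (hε : ε ≤ 3 / 10000) (w2 w3 w4 : ℂ) :
    ¬ MainOrderContradictionP D d w2 w3 w4 C233 :=
  (not_mainOrderContradictionP_weyl hS (hε.trans (by norm_num)) w2 w3 w4).1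

end Literature.NumberTheory.LFunctions.Zhang2022
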